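import Mathlib
import Summits.Ventures.PercRepro2.Independence
import Summits.Ventures.PercRepro2.Harris
import Summits.Ventures.PercRepro2.HCov
import Summits.Ventures.PercRepro2.CutVertexPaths
import Summits.Ventures.PercRepro2.CutOneFarConn
import Summits.Ventures.PercRepro2.CutTwoFarConn
import Summits.Ventures.PercRepro2.CutTwoFarLaw
import Summits.Ventures.PercRepro2.CutTwoFar
import Summits.Ventures.PercRepro2.CutTwoFarHarris
import Summits.Ventures.PercRepro2.CutTwoFarRootsLaw
import Summits.Ventures.PercRepro2.CutTwoFarRightPat
import Summits.Ventures.PercRepro2.CutTwoFarRoots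
import Summits.Ventures.PercRepro2.CutTwoFarOBConn
import Summits.Ventures.PercRepro2.CutTwoFarOBMasses
import Summits.Ventures.PercRepro2.CutTwoFarOB
import Summits.Ventures.PercRepro2.CutTwoFarABConn
import Summits.Ventures.PercRepro2.CutTwoFarABMasses
import Summits.Ventures.PercRepro2.CutTwoFarAB
import Summits.Ventures.PercRepro2.CutTwoFarOAConn
import Summits.Ventures.PercRepro2.CutTwoFarOAMasses
import Summits.Ventures.PercRepro2.CutTwoFarOA

/-!
# Two marks behind a cut vertex: THE FOUR CLASS THEOREMS, BOTH ORIENTATIONS (blind cell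
PercRepro2, typer-1 g50)

(HCOV) on four of the ten two-far-mark cut-vertex classes of S3.5 (MINE2-CUTVERTEX §13.2), for
every admissible weight vector and every weighted part on either side, the cut vertex marked or
not: the two far marks `{a₁, a₂}` (T1, `HCov_rootsFar`), `{o, b}` (T3, `HCov_obFar`), `{a₃, b}`
(T4, `HCov_a3bFar`) and `{o, a₃}` (T2, `HCov_oa3Far`) on the left of the cut vertex `v`
(`CutVertex ends side L v Rt`), and the same with the sides swapped (`CutVertex.symm`).  Own work;
standard axioms.
-/

namespace Summit.Ventures.PercRepro2

open CovForm CutVertexM9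

namespace CutTwoFar

section Classes

variable {V : Type*} {E : Type*} [Fintype E] [DecidableEq E] {R : Type*} [Field R]
  [LinearOrder R] [IsStrictOrderedRing R]
variable {ends : E → Sym2 V} {side : E → Bool} {L : Set V} {v : V} {Rt : Set V}
  (h : CutVertex ends side L v Rt) {o a₁ a₂ a₃ b : V} {p : E → R} (hp : IsProbVec p)
include h hp

/-- **Both roots behind the cut vertex** (T1): `a₁, a₂ ∈ L ∪ {v}`, `o, a₃, b ∈ Rt ∪ {v}`. -/
theorem HCov_cut_roots (h₁ : a₁ ∈ L ∨ a₁ = v) (h₂ : a₂ ∈ L ∨ a₂ = v) (ho : o ∈ Rt ∨ o = v)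
    (h3 : a₃ ∈ Rt ∨ a₃ = v) (hb : b ∈ Rt ∨ b = v) : HCov p ends o a₁ a₂ a₃ b :=
  HCov_rootsFar h h₁ h₂ p ho h3 hb hp

/-- **Both roots behind the cut vertex**, the sides swapped (T1). -/
theorem HCov_cut_roots' (h₁ : a₁ ∈ Rt ∨ a₁ = v) (h₂ : a₂ ∈ Rt ∨ a₂ = v) (ho : o ∈ L ∨ o = v)
    (h3 : a₃ ∈ L ∨ a₃ = v) (hb : b ∈ L ∨ b = v) : HCov p ends o a₁ a₂ a₃ b :=
  HCov_rootsFar h.symm h₁ h₂ p ho h3 hb hp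

/-- **`o` and `b` behind the cut vertex** (T3). -/
theorem HCov_cut_ob [DecidableEq V] (ho : o ∈ L ∨ o = v) (hb : b ∈ L ∨ b = v)
    (h₁ : a₁ ∈ Rt ∨ a₁ = v) (h₂ : a₂ ∈ Rt ∨ a₂ = v) (h3 : a₃ ∈ Rt ∨ a₃ = v) :
    HCov p ends o a₁ a₂ a₃ b :=
  HCov_obFar h p ho hb h₁ h₂ h3 hp

/-- **`o` and `b` behind the cut vertex**, the sides swapped (T3). -/
theorem HCov_cut_ob' [DecidableEq V] (ho : o ∈ Rt ∨ o = v) (hb : b ∈ Rt ∨ b = v)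
    (h₁ : a₁ ∈ L ∨ a₁ = v) (h₂ : a₂ ∈ L ∨ a₂ = v) (h3 : a₃ ∈ L ∨ a₃ = v) :
    HCov p ends o a₁ a₂ a₃ b :=
  HCov_obFar h.symm p ho hb h₁ h₂ h3 hp

/-- **`a₃` and `b` behind the cut vertex** (T4). -/
theorem HCov_cut_a3b [Fintype V] [DecidableEq V] (h3 : a₃ ∈ L ∨ a₃ = v) (hb : b ∈ L ∨ b = v)
    (h₁ : a₁ ∈ Rt ∨ a₁ = v) (h₂ : a₂ ∈ Rt ∨ a₂ = v) (ho : o ∈ Rt ∨ o = v) :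
    HCov p ends o a₁ a₂ a₃ b :=
  HCov_a3bFar h p h3 hb h₁ h₂ ho hp

/-- **`a₃` and `b` behind the cut vertex**, the sides swapped (T4). -/
theorem HCov_cut_a3b' [Fintype V] [DecidableEq V] (h3 : a₃ ∈ Rt ∨ a₃ = v) (hb : b ∈ Rt ∨ b = v)
    (h₁ : a₁ ∈ L ∨ a₁ = v) (h₂ : a₂ ∈ L ∨ a₂ = v) (ho : o ∈ L ∨ o = v) :
    HCov p ends o a₁ a₂ a₃ b :=
  HCov_a3bFar h.symm p h3 hb h₁ h₂ ho hp

/-- **`o` and `a₃` behind the cut vertex** (T2). -/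
theorem HCov_cut_oa3 [Fintype V] [DecidableEq V] (ho : o ∈ L ∨ o = v) (h3 : a₃ ∈ L ∨ a₃ = v)
    (h₁ : a₁ ∈ Rt ∨ a₁ = v) (h₂ : a₂ ∈ Rt ∨ a₂ = v) (hb : b ∈ Rt ∨ b = v) :
    HCov p ends o a₁ a₂ a₃ b :=
  HCov_oa3Far h p ho h3 h₁ h₂ hb hp

/-- **`o` and `a₃` behind the cut vertex**, the sides swapped (T2). -/
theorem HCov_cut_oa3' [Fintype V] [DecidableEq V] (ho : o ∈ Rt ∨ o = v) (h3 : a₃ ∈ Rt ∨ a₃ = v)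
    (h₁ : a₁ ∈ L ∨ a₁ = v) (h₂ : a₂ ∈ L ∨ a₂ = v) (hb : b ∈ L ∨ b = v) :
    HCov p ends o a₁ a₂ a₃ b :=
  HCov_oa3Far h.symm p ho h3 h₁ h₂ hb hp

end Classes

end CutTwoFar

end Summit.Ventures.PercRepro2
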